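import Mathlib
import Summits.ValiantsHypothesis.ValiantsHypothesis.Theorems.RigidityForcesSymmetryRankRigidMinimalReprPermPatternThree
import Summits.ValiantsHypothesis.ValiantsHypothesis.Theorems.RigidityForcesSymmetryRankRigidMinimalReprLevelBoundOfLaplace

/-!
# Laplace optimality of orders `2` and `3`, and the tied level counts re-derived from the engine
# (crux `RankRigidMinimalRepr`, stmt-ValiantsHypothesis-18034, route `RigidityForcesSymmetry`)

The two known instances of the finite input `LaplaceOptimal d` (`…LaplaceDefs.lean`) of the engine
`levelBound_of_laplaceOptimal` (`…LevelBoundOfLaplace.lean`):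

* `laplaceOptimal_two` — order `2`: a family of split-rank-one terms summing to the pattern `[v injective]` on
  `Fin 2 → Fin 2` has total weight `Σ |S_t|!(2-|S_t|)! ≥ 2`; the only cheaper families are the empty one (but the
  pattern is non-zero) and a single term across `{i} | {j}` (but `U(v i) W(v j)` has rank `≤ 1` on the `2 × 2` block,
  the pattern `[[0,1],[1,0]]` rank `2`).
* `laplaceOptimal_three` — order `3`: total weight `≥ 6`; a cheaper family has no full term and at most two split terms,
  each a SLICE (`term_isSlice_three`), contradicting `permPattern_three_not_two_slices` (`…PermPatternThree.lean`:
  the `3 × 3 × 3` permutation pattern is not a sum of two slices).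

Consequences (`levelBound_two_tied_of_engine`, `levelBound_three_tied_of_engine`): the level counts for two and three
tied columns, now for all `m ≥ 2` resp. `m ≥ 3` and `s ≤ m` — uniform re-derivations of the landed `stub_levelBound` and
`levelBound_threeTied`.  `LaplaceOptimal 4` (which would give four tied columns) is open; numerical searches are
recorded on the crux item.

HONEST FRAMING: helpers toward the rungs `TiedTorusBound k` of crux `RankRigidMinimalRepr` (each rung also needs the
dictionary stub `stub_levelDecomp`); no bearing on `VP ≠ VNP`.
-/

set_option autoImplicit false

-- the mandated summit-side namespace repeats a component by design (single-problem summit)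
set_option linter.dupNamespace false

open Finset
open Summit.ValiantsHypothesis.ValiantsHypothesis.Theorems.RigidityForcesSymmetryPairTiedTorusBound

namespace Summit.ValiantsHypothesis.ValiantsHypothesis.Theorems.RigidityForcesSymmetryRankRigidMinimalRepr

noncomputable section

open scoped Classical

/-! ### §1 `LaplaceOptimal 2`: the anti-identity `[[0,1],[1,0]]` is not of rank `≤ 1` -/

/-- Injectivity of a pair of values. -/
theorem vec2_injective_iff (a b : Fin 2) : Function.Injective ![a, b] ↔ a ≠ b := by
  revert a b; decide

/-- The weight `|S|! (2 - |S|)!` of a split of `Fin 2` is `≥ 1`, and `≥ 2` unless `|S| = 1`. -/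
theorem weight_two_le (S : Finset (Fin 2)) :
    1 ≤ S.card.factorial * (2 - S.card).factorial ∧
      (S.card ≠ 1 → 2 ≤ S.card.factorial * (2 - S.card).factorial) := by
  refine ⟨Nat.mul_pos (Nat.factorial_pos _) (Nat.factorial_pos _), fun h1 => ?_⟩
  have hle : S.card ≤ 2 := by simpa using Finset.card_le_univ S
  have : S.card = 0 ∨ S.card = 2 := by omega
  rcases this with h | h <;> simp [h]

/-- **`LaplaceOptimal 2`.**  A single split-rank-one term across `{i} | {j}` is `U(v i) · W(v j)`, of rank `≤ 1` on the
`2 × 2` block, while the pattern `[v injective]` is the anti-identity of rank `2`; the empty family gives `0 ≠ 1`. -/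
theorem laplaceOptimal_two : LaplaceOptimal 2 := by
  intro N T S u w hu hw hsum
  by_contra hlt
  rw [not_le, Nat.factorial_two] at hlt
  have hall : ∀ t ∈ T, (S t).card = 1 := fun t ht => by
    by_contra h
    have := ((weight_two_le (S t)).2 h).trans (Finset.single_le_sum
      (f := fun t => (S t).card.factorial * (2 - (S t).card).factorial) (fun _ _ => Nat.zero_le _) ht)
    omega
  have hT1 : T.card ≤ 1 := by
    have : T.card ≤ ∑ t ∈ T, (S t).card.factorial * (2 - (S t).card).factorial := by
      rw [Finset.card_eq_sum_ones]; exact Finset.sum_le_sum fun t _ => (weight_two_le (S t)).1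
    omega
  rcases T.eq_empty_or_nonempty with hT0 | ⟨t₀, ht₀⟩
  · have := hsum ![0, 1]
    rw [hT0, Finset.sum_empty, if_pos ((vec2_injective_iff 0 1).2 (by decide))] at this
    exact zero_ne_one this
  · have hTeq : T = {t₀} :=
      Finset.eq_singleton_iff_unique_mem.2 ⟨ht₀, fun t ht => Finset.card_le_one.1 hT1 t ht t₀ ht₀⟩
    obtain ⟨i₀, hi₀⟩ := Finset.card_eq_one.1 (hall t₀ ht₀)
    have key : ∀ v : Fin 2 → Fin 2, u t₀ v * w t₀ v = if Function.Injective v then 1 else 0 := fun v => by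
      have := hsum v; rwa [hTeq, Finset.sum_singleton] at this
    have e01 := key ![0, 1]
    have e10 := key ![1, 0]
    have e00 := key ![0, 0]
    rw [if_pos ((vec2_injective_iff _ _).2 (by decide))] at e01 e10
    rw [if_neg (fun h => absurd rfl ((vec2_injective_iff _ _).1 h))] at e00
    fin_cases i₀
    · -- `S t₀ = {0}`: `u` sees `v 0`, `w` sees `v 1`
      have hU : ∀ a b : Fin 2, u t₀ ![a, b] = u t₀ ![a, 0] := fun a b =>
        hu t₀ _ _ fun i hi => by
          rw [hi₀] at hi; simp only [Fin.zero_eta, Fin.isValue, Finset.mem_singleton] at hi; subst hi; rfl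
      have hW : ∀ a b : Fin 2, w t₀ ![a, b] = w t₀ ![0, b] := fun a b =>
        hw t₀ _ _ fun i hi => by
          rw [hi₀] at hi; simp only [Fin.zero_eta, Fin.isValue, Finset.mem_singleton] at hi
          fin_cases i
          · exact absurd rfl hi
          · rfl
      rw [hU 0 1, hW 0 1] at e01
      rw [hU 1 0, hW 1 0] at e10
      rw [hU 0 0, hW 0 0] at e00
      have : (u t₀ ![0, 0] * w t₀ ![0, 0]) * (u t₀ ![1, 0] * w t₀ ![0, 1]) =
          (u t₀ ![0, 0] * w t₀ ![0, 1]) * (u t₀ ![1, 0] * w t₀ ![0, 0]) := by ring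
      rw [e00, e01, e10, zero_mul, mul_one] at this
      exact zero_ne_one this
    · -- `S t₀ = {1}`: `u` sees `v 1`, `w` sees `v 0`
      have hU : ∀ a b : Fin 2, u t₀ ![a, b] = u t₀ ![0, b] := fun a b =>
        hu t₀ _ _ fun i hi => by
          rw [hi₀] at hi; simp only [Fin.mk_one, Fin.isValue, Finset.mem_singleton] at hi; subst hi; rfl
      have hW : ∀ a b : Fin 2, w t₀ ![a, b] = w t₀ ![a, 0] := fun a b =>
        hw t₀ _ _ fun i hi => by
          rw [hi₀] at hi; simp only [Fin.mk_one, Fin.isValue, Finset.mem_singleton] at hi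
          fin_cases i
          · rfl
          · exact absurd rfl hi
      rw [hU 0 1, hW 0 1] at e01
      rw [hU 1 0, hW 1 0] at e10
      rw [hU 0 0, hW 0 0] at e00
      have : (u t₀ ![0, 0] * w t₀ ![0, 0]) * (u t₀ ![0, 1] * w t₀ ![1, 0]) =
          (u t₀ ![0, 1] * w t₀ ![0, 0]) * (u t₀ ![0, 0] * w t₀ ![1, 0]) := by ring
      rw [e00, e01, e10, zero_mul, mul_one] at this
      exact zero_ne_one this

/-! ### §2 `LaplaceOptimal 3`: the permutation pattern of order `3` is not a sum of two slices -/

/-- Injectivity of a triple of values. -/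
theorem vec3_injective_iff (a b c : Fin 3) : Function.Injective ![a, b, c] ↔ (a ≠ b ∧ a ≠ c ∧ b ≠ c) := by
  revert a b c; decide

/-- The weight `|S|! (3 - |S|)!` of a split of `Fin 3` is `≥ 2`, and `≥ 6` unless `|S| ∈ {1, 2}`. -/
theorem weight_three_le (S : Finset (Fin 3)) :
    2 ≤ S.card.factorial * (3 - S.card).factorial ∧
      (¬ (S.card = 1 ∨ S.card = 2) → 6 ≤ S.card.factorial * (3 - S.card).factorial) := by
  have hle : S.card ≤ 3 := by simpa using Finset.card_le_univ S
  have : S.card = 0 ∨ S.card = 1 ∨ S.card = 2 ∨ S.card = 3 := by omega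
  rcases this with h | h | h | h <;> simp [h, Nat.factorial]

/-- A split-rank-one term across a non-trivial split `S | Sᶜ` of `Fin 3` is a SLICE along the position isolated by the
split (in the format of `permPattern_three_not_two_slices`). -/
theorem term_isSlice_three (S : Finset (Fin 3)) (u w : (Fin 3 → Fin 3) → ℂ)
    (hu : ∀ v v' : Fin 3 → Fin 3, (∀ i ∈ S, v i = v' i) → u v = u v')
    (hw : ∀ v v' : Fin 3 → Fin 3, (∀ i, i ∉ S → v i = v' i) → w v = w v')
    (hS : S.card = 1 ∨ S.card = 2) :
    ∃ i : Fin 3, ∃ φ : Fin 3 → ℂ, ∃ Ψ : Fin 3 → Fin 3 → ℂ, ∀ a b c : Fin 3,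
      u ![a, b, c] * w ![a, b, c] =
        (if i = 0 then φ a * Ψ b c else if i = 1 then φ b * Ψ a c else φ c * Ψ a b) := by
  have h10 : (1 : Fin 3) ≠ 0 := by decide
  have h20 : (2 : Fin 3) ≠ 0 := by decide
  have h21 : (2 : Fin 3) ≠ 1 := by decide
  rcases hS with h1 | h2
  · obtain ⟨x, rfl⟩ := Finset.card_eq_one.1 h1
    fin_cases x
    · refine ⟨0, fun a => u ![a, 0, 0], fun b c => w ![0, b, c], fun a b c => ?_⟩
      rw [if_pos rfl, hu ![a, b, c] ![a, 0, 0], hw ![a, b, c] ![0, b, c]]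
      · intro i hi; fin_cases i <;> simp [Finset.mem_singleton] at hi ⊢
      · intro i hi; fin_cases i <;> simp [Finset.mem_singleton] at hi ⊢
    · refine ⟨1, fun b => u ![0, b, 0], fun a c => w ![a, 0, c], fun a b c => ?_⟩
      rw [if_neg h10, if_pos rfl, hu ![a, b, c] ![0, b, 0], hw ![a, b, c] ![a, 0, c]]
      · intro i hi; fin_cases i <;> simp [Finset.mem_singleton] at hi ⊢
      · intro i hi; fin_cases i <;> simp [Finset.mem_singleton] at hi ⊢
    · refine ⟨2, fun c => u ![0, 0, c], fun a b => w ![a, b, 0], fun a b c => ?_⟩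
      rw [if_neg h20, if_neg h21, hu ![a, b, c] ![0, 0, c], hw ![a, b, c] ![a, b, 0]]
      · intro i hi; fin_cases i <;> simp [Finset.mem_singleton] at hi ⊢
      · intro i hi; fin_cases i <;> simp [Finset.mem_singleton] at hi ⊢
  · obtain ⟨x, y, hxy, rfl⟩ := Finset.card_eq_two.1 h2
    fin_cases x <;> fin_cases y
    · exact absurd rfl hxy
    · -- `{0, 1}`: slice along the third position
      refine ⟨2, fun c => w ![0, 0, c], fun a b => u ![a, b, 0], fun a b c => ?_⟩
      rw [if_neg h20, if_neg h21, hu ![a, b, c] ![a, b, 0], hw ![a, b, c] ![0, 0, c], mul_comm]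
      · intro i hi; fin_cases i <;> simp [Finset.mem_insert, Finset.mem_singleton] at hi ⊢
      · intro i hi; fin_cases i <;> simp [Finset.mem_insert, Finset.mem_singleton] at hi ⊢
    · -- `{0, 2}`: slice along the second position
      refine ⟨1, fun b => w ![0, b, 0], fun a c => u ![a, 0, c], fun a b c => ?_⟩
      rw [if_neg h10, if_pos rfl, hu ![a, b, c] ![a, 0, c], hw ![a, b, c] ![0, b, 0], mul_comm]
      · intro i hi; fin_cases i <;> simp [Finset.mem_insert, Finset.mem_singleton] at hi ⊢
      · intro i hi; fin_cases i <;> simp [Finset.mem_insert, Finset.mem_singleton] at hi ⊢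
    · -- `{1, 0}`
      refine ⟨2, fun c => w ![0, 0, c], fun a b => u ![a, b, 0], fun a b c => ?_⟩
      rw [if_neg h20, if_neg h21, hu ![a, b, c] ![a, b, 0], hw ![a, b, c] ![0, 0, c], mul_comm]
      · intro i hi; fin_cases i <;> simp [Finset.mem_insert, Finset.mem_singleton] at hi ⊢
      · intro i hi; fin_cases i <;> simp [Finset.mem_insert, Finset.mem_singleton] at hi ⊢
    · exact absurd rfl hxy
    · -- `{1, 2}`: slice along the first position
      refine ⟨0, fun a => w ![a, 0, 0], fun b c => u ![0, b, c], fun a b c => ?_⟩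
      rw [if_pos rfl, hu ![a, b, c] ![0, b, c], hw ![a, b, c] ![a, 0, 0], mul_comm]
      · intro i hi; fin_cases i <;> simp [Finset.mem_insert, Finset.mem_singleton] at hi ⊢
      · intro i hi; fin_cases i <;> simp [Finset.mem_insert, Finset.mem_singleton] at hi ⊢
    · -- `{2, 0}`
      refine ⟨1, fun b => w ![0, b, 0], fun a c => u ![a, 0, c], fun a b c => ?_⟩
      rw [if_neg h10, if_pos rfl, hu ![a, b, c] ![a, 0, c], hw ![a, b, c] ![0, b, 0], mul_comm]
      · intro i hi; fin_cases i <;> simp [Finset.mem_insert, Finset.mem_singleton] at hi ⊢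
      · intro i hi; fin_cases i <;> simp [Finset.mem_insert, Finset.mem_singleton] at hi ⊢
    · -- `{2, 1}`
      refine ⟨0, fun a => w ![a, 0, 0], fun b c => u ![0, b, c], fun a b c => ?_⟩
      rw [if_pos rfl, hu ![a, b, c] ![0, b, c], hw ![a, b, c] ![a, 0, 0], mul_comm]
      · intro i hi; fin_cases i <;> simp [Finset.mem_insert, Finset.mem_singleton] at hi ⊢
      · intro i hi; fin_cases i <;> simp [Finset.mem_insert, Finset.mem_singleton] at hi ⊢
    · exact absurd rfl hxy

/-- **`LaplaceOptimal 3`** — from `permPattern_three_not_two_slices` (`…PermPatternThree.lean`): if the total weight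
were `< 6`, no term would be of full type and at most two terms, all slices, would sum to the pattern. -/
theorem laplaceOptimal_three : LaplaceOptimal 3 := by
  intro N T S u w hu hw hsum
  by_contra hlt
  rw [not_le, show Nat.factorial 3 = 6 by rfl] at hlt
  have hall : ∀ t ∈ T, (S t).card = 1 ∨ (S t).card = 2 := fun t ht => by
    by_contra h
    have := ((weight_three_le (S t)).2 h).trans (Finset.single_le_sum
      (f := fun t => (S t).card.factorial * (3 - (S t).card).factorial) (fun _ _ => Nat.zero_le _) ht)
    omega
  have hT2 : T.card ≤ 2 := by
    have : 2 * T.card ≤ ∑ t ∈ T, (S t).card.factorial * (3 - (S t).card).factorial := by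
      rw [Finset.card_eq_sum_ones, Finset.mul_sum]
      exact Finset.sum_le_sum fun t _ => by simpa using (weight_three_le (S t)).1
    omega
  -- the pattern on `Fin 3`, as a function of three values
  have hpat : ∀ a ∈ ({0, 1, 2} : Finset (Fin 3)), ∀ b ∈ ({0, 1, 2} : Finset (Fin 3)),
      ∀ c ∈ ({0, 1, 2} : Finset (Fin 3)),
      (∑ t ∈ T, u t ![a, b, c] * w t ![a, b, c]) = if a ≠ b ∧ a ≠ c ∧ b ≠ c then 1 else 0 := by
    intro a _ b _ c _
    rw [hsum]
    exact if_congr (vec3_injective_iff a b c) rfl rfl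
  have hslice : ∀ t ∈ T, ∃ i : Fin 3, ∃ φ : Fin 3 → ℂ, ∃ Ψ : Fin 3 → Fin 3 → ℂ, ∀ a b c : Fin 3,
      u t ![a, b, c] * w t ![a, b, c] =
        (if i = 0 then φ a * Ψ b c else if i = 1 then φ b * Ψ a c else φ c * Ψ a b) :=
    fun t ht => term_isSlice_three (S t) (u t) (w t) (hu t) (hw t) (hall t ht)
  have d01 : (0 : Fin 3) ≠ 1 := by decide
  have d02 : (0 : Fin 3) ≠ 2 := by decide
  have d12 : (1 : Fin 3) ≠ 2 := by decide
  have hT012 : T.card = 0 ∨ T.card = 1 ∨ T.card = 2 := by omega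
  rcases hT012 with h0 | h1 | h2
  · rw [Finset.card_eq_zero] at h0
    have := hpat 0 (by simp) 1 (by simp) 2 (by simp)
    rw [h0, Finset.sum_empty, if_pos ⟨d01, d02, d12⟩] at this
    exact zero_ne_one this
  · obtain ⟨t₀, hSt⟩ := Finset.card_eq_one.1 h1
    obtain ⟨i, φ, Ψ, hB⟩ := hslice t₀ (by rw [hSt]; exact Finset.mem_singleton_self _)
    refine permPattern_three_not_two_slices d01 d02 d12 (fun a b c => ∑ t ∈ T, u t ![a, b, c] * w t ![a, b, c])
      hpat i 0 (fun a b c => u t₀ ![a, b, c] * w t₀ ![a, b, c]) (fun _ _ _ => 0) ⟨φ, Ψ, hB⟩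
      ⟨fun _ => 0, fun _ _ => 0, fun _ _ _ => by simp⟩ fun a _ b _ c _ => ?_
    rw [hSt, Finset.sum_singleton, add_zero]
  · obtain ⟨t₁, t₂, hne, hSt⟩ := Finset.card_eq_two.1 h2
    obtain ⟨i, φ, Ψ, hB₁⟩ := hslice t₁ (by rw [hSt]; simp)
    obtain ⟨j, φ', Ψ', hB₂⟩ := hslice t₂ (by rw [hSt]; simp)
    refine permPattern_three_not_two_slices d01 d02 d12 (fun a b c => ∑ t ∈ T, u t ![a, b, c] * w t ![a, b, c])
      hpat i j (fun a b c => u t₁ ![a, b, c] * w t₁ ![a, b, c]) (fun a b c => u t₂ ![a, b, c] * w t₂ ![a, b, c])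
      ⟨φ, Ψ, hB₁⟩ ⟨φ', Ψ', hB₂⟩ fun a _ b _ c _ => ?_
    rw [hSt, Finset.sum_pair hne]

/-! ### §3 The landed level counts re-derived from the engine -/

/-- The level count for TWO tied columns (the registered stub `stub_levelBound`, here for all `m ≥ 2`, `s ≤ m`) from the
engine and `LaplaceOptimal 2`. -/
theorem levelBound_two_tied_of_engine :
    ∀ m : ℕ, 2 ≤ m → ∀ s w : ℕ, s ≤ m → TiedLevelDecomposable m 1 s w → m.choose s ≤ w :=
  levelBound_of_laplaceOptimal laplaceOptimal_two

/-- The level count for THREE tied columns (`levelBound_threeTied`, here for all `m ≥ 3`, `s ≤ m`) from the engine and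
`LaplaceOptimal 3`. -/
theorem levelBound_three_tied_of_engine :
    ∀ m : ℕ, 3 ≤ m → ∀ s w : ℕ, s ≤ m → TiedLevelDecomposable m 2 s w → m.choose s ≤ w :=
  levelBound_of_laplaceOptimal laplaceOptimal_three

/-! ### §4 (appended) `LaplaceOptimal 1` and the untied floor count from the engine -/

/-- **`LaplaceOptimal 1`** (degenerate order: one tied column, i.e. no tie): the pattern on `Fin 1 → Fin 1` is the
constant `1`, every term weighs `1`, and the family cannot be empty. -/
theorem laplaceOptimal_one : LaplaceOptimal 1 := by
  intro N T S u w _ _ hsum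
  by_contra hlt
  rw [not_le, Nat.factorial_one, Nat.lt_one_iff, Finset.sum_eq_zero_iff] at hlt
  have hT : T = ∅ := by
    by_contra hne
    obtain ⟨t, ht⟩ := Finset.nonempty_iff_ne_empty.2 hne
    have := hlt t ht
    exact absurd this (Nat.mul_pos (Nat.factorial_pos _) (Nat.factorial_pos _)).ne'
  have := hsum id
  rw [hT, Finset.sum_empty, if_pos Function.injective_id] at this
  exact zero_ne_one this

/-- The level count with ONE "tied" column (`k = 0`, i.e. the fully typed floor: `TiedLevelDecomposable m 0 s w → C(m,s) ≤ w`
for `m ≥ 1`, `s ≤ m`) from the engine and `LaplaceOptimal 1` — the polynomial-identity form of the floor's pigeonhole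
(`torusBound_levelCount` / `levelCard_choose_le` count eigenspaces instead). -/
theorem levelBound_one_tied_of_engine :
    ∀ m : ℕ, 1 ≤ m → ∀ s w : ℕ, s ≤ m → TiedLevelDecomposable m 0 s w → m.choose s ≤ w :=
  levelBound_of_laplaceOptimal laplaceOptimal_one

end

end Summit.ValiantsHypothesis.ValiantsHypothesis.Theorems.RigidityForcesSymmetryRankRigidMinimalRepr
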